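import Literature.NumberTheory.Sieve.MatomakiRadziwillLemma3
import HarnessLib

/-!
# Matomäki–Radziwiłł 2016, Lemma 3 for COMPLEX multiplicative functions (the structure of Lemma A.4 of MRT 2015)

Topic `Literature/NumberTheory/Sieve`.  Everything in this file is PROVED; the new definitions are the complex
analogues `summandRC`, `wRC`, `siftedTwistC` of the real-coefficient objects of `MatomakiRadziwillLemma3.lean` /
`MatomakiRadziwillLemma3Halasz.lean`; no named facts.

Lemma 3 of K. Matomäki, M. Radziwiłł, *Multiplicative functions in short intervals*, Ann. of Math. 183 (2016), §2,
bounds `R(1+it) = ∑_{X ≤ n ≤ 2X} f(n) n^{-1-it}/(#{p ∈ [P,Q] : p ∣ n} + 1)` for a REAL multiplicative `f` and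
`t ≥ (log X)^{1/16}`; Matomäki–Radziwiłł–Tao 2015, Appendix A, Lemma A.4 states the same bound for a COMPLEX `f`
and `t ∈ 𝒯₂ = {|t - t₁| ≥ (log X)^{1/16}}` ("This was the only part in the proof [MR] that needed `f` to be
real-valued").  The printed proof of Lemma 3 uses realness only through Lemma 2 (the lower bound for the distance
`𝔻(f 1_{S-free} n^{-it}, n^{iy}; x)²` on the fibres).  This file re-runs the tree's proof of Lemma 3 for
`f : ArithmeticFunction ℂ` with that lower bound abstracted into a hypothesis: a Halász window `T_H ≥ 1` and a floor
`M₀ ≤ 𝔻(G, n^{iy}; Y)²` (`|y| ≤ 2T_H`, heights `Y ≥ Y_* = X^{1/4}/2`, `G = siftedTwistC f S t`).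

* `summandRC`, `wRC`, `siftedTwistC` (+ `_apply`, multiplicativity, `1`-boundedness) — the complex objects;
* `summandRC_fiber`, `sum_fiber_eq`, `norm_sum_small_sPart_le`, `norm_sum_large_sPart_le` — the splitting
  `n = n₁ n₂` (verbatim ports);
* `fibre_bound`, `first_part_le` — the first part with `(M₀, T_H)` in place of Lemma 2:
  `‖∑_{s_S(n) ≤ X^{3/4}} F(n)‖ ≤ e^{Σ_S + C₀} · 6 (C_H e^{-(39/40) M₀} + C_H (1/T_H + log log 2X/log Y_*))`;
* `norm_sum_filter_summandRC_le_two`, `second_part_rankin`, `second_b1`, `second_b2i`, `second_b2ii`,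
  `second_part_numeric` — the second part (verbatim ports; no distance input).

The consumer (Lemma A.4 for the sifted copies `f g_𝒥` of a completely multiplicative `f`, file to follow) supplies
`M₀ ≍ 0.067 log log X` from the Granville–Soundararajan device relative to the minimiser `t₁(f)` and the
Vinogradov–Korobov prime tail, and `T_H = (log X)^{1/16}/4`.

## References
* K. Matomäki, M. Radziwiłł, Ann. of Math. (2) 183 (2016) (arXiv:1501.04585), §2, Lemmas 1–3.
  [cite: MatomakiRadziwillAnnals2016, Lemma 3]
* K. Matomäki, M. Radziwiłł, T. Tao, Algebra & Number Theory 9 (2015), Appendix A, Lemma A.4.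
  [cite: MatomakiRadziwillTao2015, Appendix A, Lemma A.4]
-/

noncomputable section

open Finset Real Complex
open Literature.NumberTheory.LFunctions.GranvilleSoundararajan
open Literature.NumberTheory.Sieve.MatomakiRadziwillL4A

namespace Literature.NumberTheory.Sieve

namespace MatomakiRadziwillL3C

open MatomakiRadziwillL13 (sPart sPart_pos sPart_dvd primeFactors_sPart_subset sPart_mem_factoredNumbers
  dvd_sPart_of_dvd sPart_le)
open MatomakiRadziwillL3 (SFree sFree_div_sPart coprime_of_factored_of_sFree sPart_mul_eq sFree_of_sPart_eq
  sieveInd sieveInd_apply norm_sieveInd_le isMultiplicative_sieveInd sieveInd_of_sFree sieveInd_of_not_sFree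
  dvd_iff_dvd_sPart image_div_eq_Icc primesPQ primesPQ_prime primeDivisorsIn_sPart Ystar Sig SigAll
  sum_inv_factored_le fibre_endpoints loglog_ratio_le halasz_of_GS norm_sum_Icc_div_le sum_inv_Icc_le_two
  sum_inv_le_one_add_log sum_rpow_primesPQ_le SigAll_eq SigAll_le exp_SigAll_le T1 T2 inv_rpow_le_T1 T2_pos
  aux_L aux_ulogu pow_four_mul_exp_neg_le log_mul_rpow_neg_le inv_log_le_inv_rpow log_sq_le_rpow loglog_two_mul_le
  exp_frac_le)

/-! ### The sifted twist of a complex arithmetic function -/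

/-- The sifted twist `G = (f · 1_S) n^{-it}` of a complex arithmetic function. [folklore] -/
def siftedTwistC (f : ArithmeticFunction ℂ) (S : Finset ℕ) (t : ℝ) : ArithmeticFunction ℂ :=
  twistAF (f.pmul (sieveInd S)) t

/-- Values of the sifted twist. [folklore] -/
theorem siftedTwistC_apply (f : ArithmeticFunction ℂ) (S : Finset ℕ) (t : ℝ) (n : ℕ) :
    siftedTwistC f S t n = f n * sieveInd S n * (n : ℂ) ^ (-(t * I)) := by
  simp [siftedTwistC, ArithmeticFunction.pmul_apply]

/-- The sifted twist is multiplicative and `1`-bounded. [folklore] -/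
theorem isMultiplicative_siftedTwistC {f : ArithmeticFunction ℂ} (hf : f.IsMultiplicative)
    {S : Finset ℕ} (hS : ∀ p ∈ S, p.Prime) (t : ℝ) : (siftedTwistC f S t).IsMultiplicative :=
  isMultiplicative_twistAF (hf.pmul (isMultiplicative_sieveInd hS)) t

/-- `‖G(n)‖ ≤ 1`. [folklore] -/
theorem norm_siftedTwistC_le {f : ArithmeticFunction ℂ} (hf : ∀ n, ‖f n‖ ≤ 1) (S : Finset ℕ) (t : ℝ)
    (n : ℕ) : ‖siftedTwistC f S t n‖ ≤ 1 := by
  refine norm_twistAF_le (fun m => ?_) t n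
  rw [ArithmeticFunction.pmul_apply, norm_mul]
  calc ‖f m‖ * ‖sieveInd S m‖ ≤ 1 * 1 :=
        mul_le_mul (hf m) (norm_sieveInd_le S m) (norm_nonneg _) zero_le_one
    _ = 1 := one_mul 1

/-- The summand `F(n) = f(n) n^{-(1+it)} / (ω(n; P, Q) + 1)` of `R(1 + it)`. [cite: MatomakiRadziwillAnnals2016, Lemma 3] -/
def summandRC (f : ArithmeticFunction ℂ) (P Q t : ℝ) (n : ℕ) : ℂ :=
  f n * (n : ℂ) ^ (-(1 + (t : ℂ) * I)) / ((primeDivisorsIn P Q n : ℂ) + 1)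

/-- `‖F(n)‖ ≤ 1/n` for `|f| ≤ 1`, `n ≥ 1`. [folklore] -/
theorem norm_summandRC_le {f : ArithmeticFunction ℂ} (hf : ∀ n, ‖f n‖ ≤ 1) (P Q t : ℝ) {n : ℕ} (hn : 1 ≤ n) :
    ‖summandRC f P Q t n‖ ≤ 1 / n := by
  have hn0 : (0 : ℝ) < n := by exact_mod_cast hn
  rw [summandRC, norm_div, norm_mul]
  have h1 : ‖(n : ℂ) ^ (-(1 + (t : ℂ) * I))‖ = 1 / n := by
    rw [Complex.norm_natCast_cpow_of_pos (by omega)]; simp [Real.rpow_neg_one]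
  have h2 : (1 : ℝ) ≤ ‖((primeDivisorsIn P Q n : ℂ) + 1)‖ := by
    have : ((primeDivisorsIn P Q n : ℂ) + 1) = ((primeDivisorsIn P Q n + 1 : ℕ) : ℂ) := by push_cast; ring
    rw [this, Complex.norm_natCast]; exact_mod_cast Nat.le_add_left 1 _
  rw [h1, div_le_iff₀ (by linarith)]
  calc ‖f n‖ * (1 / n) ≤ 1 * (1 / n) := mul_le_mul_of_nonneg_right (hf n) (by positivity)
    _ ≤ 1 / n * ‖((primeDivisorsIn P Q n : ℂ) + 1)‖ := by rw [one_mul]; nlinarith [show 0 < 1 / (n:ℝ) by positivity]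

/-- The `n₁`-weight `w(n₁) = f(n₁) n₁^{-(1+it)}/(ω(n₁)+1) = F(n₁)`, of norm `≤ 1/n₁`. [folklore] -/
abbrev wRC (f : ArithmeticFunction ℂ) (P Q t : ℝ) (n₁ : ℕ) : ℂ := summandRC f P Q t n₁

/-- **The factorisation of the summand**: for `n₁` `S`-factored (`S = 𝒫 ∩ [P,Q]`), `n₁ ∣ n`, `n ≠ 0`,
`1_{s_S(n) = n₁} F(n) = w(n₁) · G(n/n₁)/(n/n₁)` with `G = siftedTwistC f S t`. [folklore] -/
theorem summandRC_fiber {f : ArithmeticFunction ℂ} (hf : f.IsMultiplicative) (P Q t : ℝ) {n₁ n : ℕ}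
    (hn₁ : n₁ ∈ Nat.factoredNumbers (primesPQ P Q)) (hdvd : n₁ ∣ n) (hn : n ≠ 0) :
    (if sPart (primesPQ P Q) n = n₁ then summandRC f P Q t n else 0) =
      wRC f P Q t n₁ * (siftedTwistC f (primesPQ P Q) t (n / n₁) / (n / n₁ : ℕ)) := by
  set S := primesPQ P Q with hSdef
  have hS : ∀ p ∈ S, p.Prime := primesPQ_prime
  obtain ⟨m, rfl⟩ := hdvd
  have hn₁0 : n₁ ≠ 0 := (Nat.mem_factoredNumbers_iff_primeFactors_subset.1 hn₁).1
  have hm0 : m ≠ 0 := fun h => hn (by rw [h, mul_zero])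
  have hn₁pos : 0 < n₁ := Nat.pos_of_ne_zero hn₁0
  rw [Nat.mul_div_cancel_left m hn₁pos]
  by_cases hfree : SFree S m
  · -- `s_S(n₁ m) = n₁`, `G(m) = f(m) m^{-it}`, `f(n₁ m) = f(n₁) f(m)`, `ω(n₁ m) = ω(n₁)`
    have hsp : sPart S (n₁ * m) = n₁ := sPart_mul_eq hS hn₁ hfree hm0
    rw [if_pos hsp, siftedTwistC_apply, sieveInd_of_sFree hm0 hfree, mul_one]
    have hcop : Nat.Coprime n₁ m := coprime_of_factored_of_sFree hn₁ hfree
    have hω : primeDivisorsIn P Q (n₁ * m) = primeDivisorsIn P Q n₁ := by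
      rw [← primeDivisorsIn_sPart P Q hn, ← hSdef, hsp]
    rw [summandRC, wRC, summandRC, hω, hf.map_mul_of_coprime hcop, Nat.cast_mul, Complex.natCast_mul_natCast_cpow]
    have hm0' : (m : ℂ) ≠ 0 := by exact_mod_cast hm0
    have hn₁0' : (n₁ : ℂ) ≠ 0 := by exact_mod_cast hn₁0
    have hω0 : ((primeDivisorsIn P Q n₁ : ℂ) + 1) ≠ 0 := by
      have : ((primeDivisorsIn P Q n₁ : ℂ) + 1) = ((primeDivisorsIn P Q n₁ + 1 : ℕ) : ℂ) := by push_cast; ring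
      rw [this]; exact_mod_cast Nat.succ_ne_zero (primeDivisorsIn P Q n₁)
    have e : (m : ℂ) ^ (-(1 + (t : ℂ) * I)) = (m : ℂ)⁻¹ * (m : ℂ) ^ (-((t : ℂ) * I)) := by
      rw [neg_add, Complex.cpow_add _ _ hm0', Complex.cpow_neg_one]
    rw [e]
    field_simp
  · -- `m` not `S`-free: both sides vanish
    have hG : siftedTwistC f S t m = 0 := by
      rw [siftedTwistC_apply, sieveInd_of_not_sFree hfree]; simp
    rw [hG, zero_div, mul_zero, if_neg]
    intro hsp
    exact hfree (sFree_of_sPart_eq hS hn rfl hsp)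

/-- **The fibre over `n₁`** of `n ↦ s_S(n)` in `[L, U]`, summed: for `n₁` `S`-factored,
`∑_{L ≤ n ≤ U, s_S(n) = n₁} F(n) = w(n₁) ∑_{⌈L/n₁⌉ ≤ m ≤ ⌊U/n₁⌋} G(m)/m`. [folklore] -/
theorem sum_fiber_eq {f : ArithmeticFunction ℂ} (hf : f.IsMultiplicative) (P Q t : ℝ) {n₁ : ℕ}
    (hn₁ : n₁ ∈ Nat.factoredNumbers (primesPQ P Q)) {L U : ℕ} (hL : 1 ≤ L) :
    ∑ n ∈ (Finset.Icc L U).filter (fun n => sPart (primesPQ P Q) n = n₁), summandRC f P Q t n =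
      wRC f P Q t n₁ * ∑ m ∈ Finset.Icc ((L + n₁ - 1) / n₁) (U / n₁),
        siftedTwistC f (primesPQ P Q) t m / m := by
  classical
  set S := primesPQ P Q with hSdef
  have hS : ∀ p ∈ S, p.Prime := primesPQ_prime
  have hn₁0 : n₁ ≠ 0 := (Nat.mem_factoredNumbers_iff_primeFactors_subset.1 hn₁).1
  have hn₁1 : 1 ≤ n₁ := Nat.one_le_iff_ne_zero.2 hn₁0
  -- pass to the multiples of `n₁`
  have step1 : ∑ n ∈ (Finset.Icc L U).filter (fun n => sPart S n = n₁), summandRC f P Q t n =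
      ∑ n ∈ (Finset.Icc L U).filter (n₁ ∣ ·), (if sPart S n = n₁ then summandRC f P Q t n else 0) := by
    rw [Finset.sum_filter, Finset.sum_filter]
    refine Finset.sum_congr rfl fun n _ => ?_
    by_cases h : sPart S n = n₁
    · rw [if_pos h, if_pos (h ▸ sPart_dvd hS n)]
    · rw [if_neg h]; split_ifs <;> rfl
  have step2 : ∑ n ∈ (Finset.Icc L U).filter (n₁ ∣ ·), (if sPart S n = n₁ then summandRC f P Q t n else 0) =
      ∑ n ∈ (Finset.Icc L U).filter (n₁ ∣ ·), wRC f P Q t n₁ * (siftedTwistC f S t (n / n₁) / (n / n₁ : ℕ)) := by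
    refine Finset.sum_congr rfl fun n hn => ?_
    rw [Finset.mem_filter, Finset.mem_Icc] at hn
    exact summandRC_fiber hf P Q t hn₁ hn.2 (by omega)
  have step3 : ∑ n ∈ (Finset.Icc L U).filter (n₁ ∣ ·), wRC f P Q t n₁ * (siftedTwistC f S t (n / n₁) / (n / n₁ : ℕ)) =
      ∑ m ∈ ((Finset.Icc L U).filter (n₁ ∣ ·)).image (· / n₁), wRC f P Q t n₁ * (siftedTwistC f S t m / m) := by
    rw [Finset.sum_image]
    intro a ha b hb hab
    rw [Finset.mem_coe, Finset.mem_filter] at ha hb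
    obtain ⟨ka, hka⟩ := ha.2; obtain ⟨kb, hkb⟩ := hb.2
    simp only at hab
    rw [hka, hkb, Nat.mul_div_cancel_left _ (by omega), Nat.mul_div_cancel_left _ (by omega)] at hab
    rw [hka, hkb, hab]
  rw [step1, step2, step3, image_div_eq_Icc hn₁1, ← Finset.mul_sum]

/-- `‖w(n₁)‖ ≤ 1/n₁`. [folklore] -/
theorem norm_wRC_le {f : ArithmeticFunction ℂ} (hf : ∀ n, ‖f n‖ ≤ 1) (P Q t : ℝ) {n₁ : ℕ} (hn₁ : 1 ≤ n₁) :
    ‖wRC f P Q t n₁‖ ≤ 1 / n₁ := norm_summandRC_le hf P Q t hn₁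

/-- **The first part of `R`**, after the fibre decomposition:
`‖∑_{L ≤ n ≤ U, s_S(n) ≤ Z} F(n)‖ ≤ ∑_{n₁ ≤ Z, S-factored} (1/n₁) ‖∑_{⌈L/n₁⌉ ≤ m ≤ ⌊U/n₁⌋} G(m)/m‖`.
[cite: MatomakiRadziwillAnnals2016, Lemma 3 (proof, first term)] -/
theorem norm_sum_small_sPart_le {f : ArithmeticFunction ℂ} (hf : f.IsMultiplicative) (hf1 : ∀ n, ‖f n‖ ≤ 1)
    (P Q t : ℝ) {L U Zn : ℕ} (hL : 1 ≤ L) :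
    ‖∑ n ∈ (Finset.Icc L U).filter (fun n => sPart (primesPQ P Q) n ≤ Zn), summandRC f P Q t n‖ ≤
      ∑ n₁ ∈ (Finset.Icc 1 Zn).filter (· ∈ Nat.factoredNumbers (primesPQ P Q)),
        (1 : ℝ) / n₁ * ‖∑ m ∈ Finset.Icc ((L + n₁ - 1) / n₁) (U / n₁), siftedTwistC f (primesPQ P Q) t m / m‖ := by
  classical
  set S := primesPQ P Q with hSdef
  have hS : ∀ p ∈ S, p.Prime := primesPQ_prime
  set N1 := (Finset.Icc 1 Zn).filter (· ∈ Nat.factoredNumbers S) with hN1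
  have hmaps : ∀ n ∈ (Finset.Icc L U).filter (fun n => sPart S n ≤ Zn), sPart S n ∈ N1 := by
    intro n hn
    rw [Finset.mem_filter] at hn
    rw [hN1, Finset.mem_filter, Finset.mem_Icc]
    exact ⟨⟨sPart_pos hS n, hn.2⟩, sPart_mem_factoredNumbers hS n⟩
  rw [← Finset.sum_fiberwise_of_maps_to hmaps]
  refine (norm_sum_le _ _).trans (Finset.sum_le_sum fun n₁ hn₁ => ?_)
  have hn₁' := (Finset.mem_filter.1 hn₁)
  have hn₁1 : 1 ≤ n₁ := (Finset.mem_Icc.1 hn₁'.1).1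
  -- the fibre `{n : sPart n ≤ Zn ∧ sPart n = n₁} = {n : sPart n = n₁}` as `n₁ ≤ Zn`
  have hfib : ((Finset.Icc L U).filter (fun n => sPart S n ≤ Zn)).filter (fun n => sPart S n = n₁) =
      (Finset.Icc L U).filter (fun n => sPart S n = n₁) := by
    ext n; simp only [Finset.mem_filter]
    constructor
    · rintro ⟨⟨h1, -⟩, h2⟩; exact ⟨h1, h2⟩
    · rintro ⟨h1, h2⟩; exact ⟨⟨h1, h2 ▸ (Finset.mem_Icc.1 hn₁'.1).2⟩, h2⟩
  rw [hfib, sum_fiber_eq hf P Q t hn₁'.2 hL, norm_mul]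
  exact mul_le_mul_of_nonneg_right (norm_wRC_le hf1 P Q t hn₁1) (norm_nonneg _)

/-! ### The second part: `n` with a large `S`-part -/

/-- **The large-`S`-part terms**: `‖∑_{L ≤ n ≤ U, s_S(n) > Z} F(n)‖ ≤ (∑_{n₂ ≤ U/(Z+1)} 1/n₂) · ∑_{Z < n₁ ≤ U, S-fact.} 1/n₁`
(injectivity of `n ↦ (s_S(n), n/s_S(n))`). [cite: MatomakiRadziwillAnnals2016, Lemma 3 (proof, second term)] -/
theorem norm_sum_large_sPart_le {f : ArithmeticFunction ℂ} (hf1 : ∀ n, ‖f n‖ ≤ 1) (P Q t : ℝ)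
    {L U Zn : ℕ} (hL : 1 ≤ L) :
    ‖∑ n ∈ (Finset.Icc L U).filter (fun n => Zn < sPart (primesPQ P Q) n), summandRC f P Q t n‖ ≤
      (∑ n₂ ∈ Finset.Icc 1 (U / (Zn + 1)), (1 : ℝ) / n₂) *
        ∑ n₁ ∈ (Finset.Icc (Zn + 1) U).filter (· ∈ Nat.factoredNumbers (primesPQ P Q)), (1 : ℝ) / n₁ := by
  classical
  set S := primesPQ P Q with hSdef
  have hS : ∀ p ∈ S, p.Prime := primesPQ_prime
  set B := (Finset.Icc L U).filter (fun n => Zn < sPart S n) with hB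
  -- `‖∑ F‖ ≤ ∑ 1/n`
  have h1 : ‖∑ n ∈ B, summandRC f P Q t n‖ ≤ ∑ n ∈ B, (1 : ℝ) / n := by
    refine (norm_sum_le _ _).trans (Finset.sum_le_sum fun n hn => ?_)
    have : 1 ≤ n := by have := (Finset.mem_Icc.1 (Finset.mem_filter.1 hn).1).1; omega
    exact norm_summandRC_le hf1 P Q t this
  refine h1.trans ?_
  -- reindex by `n ↦ (s_S(n), n / s_S(n))`
  set φ : ℕ → ℕ × ℕ := fun n => (sPart S n, n / sPart S n) with hφ
  set R1 := (Finset.Icc (Zn + 1) U).filter (· ∈ Nat.factoredNumbers S) with hR1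
  set Tgt := R1 ×ˢ Finset.Icc 1 (U / (Zn + 1)) with hTgt
  have hmul : ∀ n, sPart S n * (n / sPart S n) = n := fun n => Nat.mul_div_cancel' (sPart_dvd hS n)
  have hmaps : ∀ n ∈ B, φ n ∈ Tgt := by
    intro n hn
    rw [hB, Finset.mem_filter, Finset.mem_Icc] at hn
    have hn0 : n ≠ 0 := by omega
    simp only [hTgt, hR1, hφ, Finset.mem_product, Finset.mem_filter, Finset.mem_Icc]
    refine ⟨⟨⟨hn.2, (sPart_le hS hn0).trans hn.1.2⟩, sPart_mem_factoredNumbers hS n⟩, ?_, ?_⟩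
    · exact Nat.pos_of_ne_zero fun h => hn0 (by rw [← hmul n, h, mul_zero])
    · calc n / sPart S n ≤ n / (Zn + 1) := Nat.div_le_div_left hn.2 (by omega)
        _ ≤ U / (Zn + 1) := Nat.div_le_div_right hn.1.2
  have hinj : Set.InjOn φ ↑B := by
    intro a _ b _ h
    have := congrArg (fun x : ℕ × ℕ => x.1 * x.2) h
    simpa only [hφ, hmul] using this
  have hval : ∀ n ∈ B, (1 : ℝ) / n = (fun x : ℕ × ℕ => (1 : ℝ) / x.1 * (1 / x.2)) (φ n) := by
    intro n _
    simp only [hφ]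
    rw [one_div_mul_one_div, ← Nat.cast_mul, hmul n]
  calc ∑ n ∈ B, (1 : ℝ) / n = ∑ n ∈ B, (fun x : ℕ × ℕ => (1 : ℝ) / x.1 * (1 / x.2)) (φ n) :=
        Finset.sum_congr rfl hval
    _ = ∑ x ∈ B.image φ, (1 : ℝ) / x.1 * (1 / x.2) := by rw [Finset.sum_image hinj]
    _ ≤ ∑ x ∈ Tgt, (1 : ℝ) / x.1 * (1 / x.2) :=
        Finset.sum_le_sum_of_subset_of_nonneg (Finset.image_subset_iff.2 hmaps) fun x _ _ => by positivity
    _ = (∑ n₁ ∈ R1, (1 : ℝ) / n₁) * ∑ n₂ ∈ Finset.Icc 1 (U / (Zn + 1)), (1 : ℝ) / n₂ := by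
        rw [hTgt, Finset.sum_product, Finset.sum_mul_sum]
    _ = _ := mul_comm _ _

/-! ### The first part: Halász on each fibre, uniformly in `n₁ ≤ X^{3/4}` -/

set_option maxHeartbeats 400000 in
/-- **The Halász bound on one fibre** (uniform in `n₁ ≤ X^{3/4}`): with the constant of `halasz_of_GS`, a Halász
window `T_H ≥ 1` and any `M₀` below the distances `𝔻(G, n^{iy}; Y)²` of the sifted twist `G` for `|y| ≤ 2T_H` at
all heights `Y ≥ Y_*` (`Y_* ≥ 4`), complex multiplicative `|f| ≤ 1` and `1 ≤ n₁ ≤ X^{3/4}`: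
`‖∑_{a ≤ m ≤ b} G(m)/m‖ ≤ 6 (C_H e^{-(39/40) M₀} + C_H (1/T_H + log log (2X) / log Y_*))`.
[cite: MatomakiRadziwillAnnals2016, Lemma 3 (proof: "apply Halász's theorem (Lemmas 1 and 2) to the sum over n₂")] -/
theorem fibre_bound {C_H : ℝ} (hC_H : 0 ≤ C_H)
    (hH : ∀ g : ArithmeticFunction ℂ, g.IsMultiplicative → (∀ n, ‖g n‖ ≤ 1) →
      ∀ x T M₀ : ℝ, 3 ≤ x → 1 ≤ T → (∀ y : ℝ, |y| ≤ 2 * T → M₀ ≤ Msum g x y) →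
        ‖∑ n ∈ Icc 1 ⌊x⌋₊, g n‖ ≤
          x * (C_H * Real.exp (-(39 / 40) * M₀) + C_H * (1 / T + Real.log (Real.log x) / Real.log x)))
    {f : ArithmeticFunction ℂ} (hf : f.IsMultiplicative) (hf1 : ∀ n, ‖f n‖ ≤ 1)
    {P Q X t : ℝ} (hX1 : 1 ≤ X) (hY4 : 4 ≤ Ystar X) {TH M₀ : ℝ} (hTH : 1 ≤ TH)
    (hM₀ : ∀ Y : ℝ, Ystar X ≤ Y → ∀ y : ℝ, |y| ≤ 2 * TH → M₀ ≤ Msum (siftedTwistC f (primesPQ P Q) t) Y y)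
    {n₁ : ℕ} (hn₁ : 1 ≤ n₁) (hn₁Z : (n₁ : ℝ) ≤ X ^ (3 / 4 : ℝ)) :
    ‖∑ m ∈ Finset.Icc ((⌈X⌉₊ + n₁ - 1) / n₁) (⌊2 * X⌋₊ / n₁), siftedTwistC f (primesPQ P Q) t m / m‖ ≤
      6 * (C_H * Real.exp (-(39 / 40) * M₀) +
        C_H * (1 / TH + Real.log (Real.log (2 * X)) / Real.log (Ystar X))) := by
  set S := primesPQ P Q with hSdef
  have hS : ∀ p ∈ S, p.Prime := primesPQ_prime
  set a : ℕ := (⌈X⌉₊ + n₁ - 1) / n₁ with ha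
  set b : ℕ := ⌊2 * X⌋₊ / n₁ with hb
  have hX0 : 0 < X := by linarith
  have hn0 : (0 : ℝ) < n₁ := by exact_mod_cast hn₁
  obtain ⟨ha_ge, hb_le⟩ := fibre_endpoints hX1 hn₁
  rw [← ha] at ha_ge; rw [← hb] at hb_le
  -- `a ≥ X/n₁ ≥ X^{1/4} = 2 Y_* ≥ 8`
  have hXn : X ^ (1 / 4 : ℝ) ≤ X / n₁ := by
    rw [le_div_iff₀ hn0]
    calc X ^ (1 / 4 : ℝ) * n₁ ≤ X ^ (1 / 4 : ℝ) * X ^ (3 / 4 : ℝ) :=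
          mul_le_mul_of_nonneg_left hn₁Z (by positivity)
      _ = X := by rw [← Real.rpow_add hX0]; norm_num
  have hYdef : Ystar X = X ^ (1 / 4 : ℝ) / 2 := rfl
  have haY : 2 * Ystar X ≤ a := by rw [hYdef]; linarith
  have ha8 : (8 : ℝ) ≤ a := by linarith
  have ha4 : 4 ≤ a := by exact_mod_cast (show (4 : ℝ) ≤ a by linarith)
  have hb2X : (b : ℝ) ≤ 2 * X := hb_le.trans (by
      rw [div_le_iff₀ hn0]; have : (1:ℝ) ≤ n₁ := by exact_mod_cast hn₁
      nlinarith)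
  have hX8 : (8 : ℝ) ≤ X := by
    have h1 : X / n₁ ≤ X := div_le_self hX0.le (by exact_mod_cast hn₁)
    have h2 : 8 ≤ X ^ (1 / 4 : ℝ) := by rw [hYdef] at hY4; linarith
    linarith
  have hll0 : 0 ≤ Real.log (Real.log (2 * X)) / Real.log (Ystar X) := by
    refine div_nonneg (Real.log_nonneg ?_) (Real.log_nonneg (by linarith))
    have h2X : (16 : ℝ) ≤ 2 * X := by linarith
    rw [← Real.log_exp 1]; refine Real.log_le_log (Real.exp_pos 1) ?_
    have := Real.exp_one_lt_d9; norm_num at this; linarith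
  have hRHS0 : 0 ≤ 6 * (C_H * Real.exp (-(39 / 40) * M₀) +
      C_H * (1 / TH + Real.log (Real.log (2 * X)) / Real.log (Ystar X))) := by positivity
  -- empty fibre
  rcases lt_or_ge b a with hba | hab
  · rw [Finset.Icc_eq_empty (by omega), Finset.sum_empty, norm_zero]; exact hRHS0
  -- Halász + partial summation on the fibre
  have ha1Y : Ystar X ≤ ((a - 1 : ℕ) : ℝ) := by
    have : ((a - 1 : ℕ) : ℝ) = a - 1 := by rw [Nat.cast_sub (by omega)]; simp
    rw [this]; linarith
  have hM : ∀ y : ℝ, |y| ≤ 2 * TH → M₀ ≤ Msum (siftedTwistC f S t) ((a - 1 : ℕ) : ℝ) y :=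
    fun y hy => hM₀ _ ha1Y y hy
  have hmain := norm_sum_Icc_div_le hC_H hH (isMultiplicative_siftedTwistC hf hS t)
    (norm_siftedTwistC_le hf1 S t) ha4 hab hTH hM
  refine hmain.trans ?_
  have hb8 : (8 : ℝ) ≤ b := ha8.trans (by exact_mod_cast hab)
  have hba6 : 3 * (b : ℝ) / a ≤ 6 := by
    rw [div_le_iff₀ (by linarith)]
    have : (b : ℝ) ≤ 2 * (X / n₁) := by rw [← mul_div_assoc]; exact hb_le
    linarith
  have hll := loglog_ratio_le (X := X) hb8 hb2X hY4 ha1Y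
  have hllb0 : 0 ≤ Real.log (Real.log b) / Real.log ((a - 1 : ℕ) : ℝ) := by
    refine div_nonneg (Real.log_nonneg ?_) (Real.log_nonneg (by linarith))
    rw [← Real.log_exp 1]; refine Real.log_le_log (Real.exp_pos 1) ?_
    have := Real.exp_one_lt_d9; norm_num at this; linarith
  have hB0 : 0 ≤ C_H * Real.exp (-(39 / 40) * M₀) +
      C_H * (1 / TH + Real.log (Real.log b) / Real.log ((a - 1 : ℕ) : ℝ)) := by positivity
  have hB : C_H * Real.exp (-(39 / 40) * M₀) +
      C_H * (1 / TH + Real.log (Real.log b) / Real.log ((a - 1 : ℕ) : ℝ)) ≤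
      C_H * Real.exp (-(39 / 40) * M₀) +
        C_H * (1 / TH + Real.log (Real.log (2 * X)) / Real.log (Ystar X)) := by
    have := mul_le_mul_of_nonneg_left hll hC_H
    linarith
  calc 3 * (b : ℝ) / a * (C_H * Real.exp (-(39 / 40) * M₀) +
        C_H * (1 / TH + Real.log (Real.log b) / Real.log ((a - 1 : ℕ) : ℝ)))
      ≤ 6 * (C_H * Real.exp (-(39 / 40) * M₀) +
        C_H * (1 / TH + Real.log (Real.log b) / Real.log ((a - 1 : ℕ) : ℝ))) :=
        mul_le_mul_of_nonneg_right hba6 hB0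
    _ ≤ _ := mul_le_mul_of_nonneg_left hB (by norm_num)

/-- **The first part of `R(1+it)`** (complex `f`, Halász window `T_H`, distance floor `M₀`):
`‖∑_{X ≤ n ≤ 2X, s_S(n) ≤ X^{3/4}} F(n)‖ ≤ e^{Σ_S + C₀} · 6 (C_H e^{-(39/40) M₀} + C_H (1/T_H + log log 2X/log Y_*))`.
[cite: MatomakiRadziwillAnnals2016, Lemma 3 (proof, first term)] -/
theorem first_part_le {C_H : ℝ} (hC_H : 0 ≤ C_H)
    (hH : ∀ g : ArithmeticFunction ℂ, g.IsMultiplicative → (∀ n, ‖g n‖ ≤ 1) →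
      ∀ x T M₀ : ℝ, 3 ≤ x → 1 ≤ T → (∀ y : ℝ, |y| ≤ 2 * T → M₀ ≤ Msum g x y) →
        ‖∑ n ∈ Icc 1 ⌊x⌋₊, g n‖ ≤
          x * (C_H * Real.exp (-(39 / 40) * M₀) + C_H * (1 / T + Real.log (Real.log x) / Real.log x)))
    {f : ArithmeticFunction ℂ} (hf : f.IsMultiplicative) (hf1 : ∀ n, ‖f n‖ ≤ 1)
    {P Q X t : ℝ} (hX1 : 1 ≤ X) (hY4 : 4 ≤ Ystar X) {TH M₀ : ℝ} (hTH : 1 ≤ TH)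
    (hM₀ : ∀ Y : ℝ, Ystar X ≤ Y → ∀ y : ℝ, |y| ≤ 2 * TH → M₀ ≤ Msum (siftedTwistC f (primesPQ P Q) t) Y y) :
    ‖∑ n ∈ (Finset.Icc ⌈X⌉₊ ⌊2 * X⌋₊).filter (fun n => sPart (primesPQ P Q) n ≤ ⌊X ^ (3 / 4 : ℝ)⌋₊),
        summandRC f P Q t n‖ ≤
      Real.exp (SigAll (primesPQ P Q) + RankinComposed.C₀) *
        (6 * (C_H * Real.exp (-(39 / 40) * M₀) +
          C_H * (1 / TH + Real.log (Real.log (2 * X)) / Real.log (Ystar X)))) := by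
  set S := primesPQ P Q with hSdef
  have hS : ∀ p ∈ S, p.Prime := primesPQ_prime
  have hL : 1 ≤ ⌈X⌉₊ := Nat.one_le_iff_ne_zero.2 (Nat.ceil_pos.2 (by linarith)).ne'
  have h1 := norm_sum_small_sPart_le hf hf1 P Q t (L := ⌈X⌉₊) (U := ⌊2 * X⌋₊) (Zn := ⌊X ^ (3 / 4 : ℝ)⌋₊) hL
  rw [← hSdef] at h1
  refine h1.trans ?_
  set Bnd := 6 * (C_H * Real.exp (-(39 / 40) * M₀) +
    C_H * (1 / TH + Real.log (Real.log (2 * X)) / Real.log (Ystar X))) with hBnd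
  have hfib : ∀ n₁ ∈ (Finset.Icc 1 ⌊X ^ (3 / 4 : ℝ)⌋₊).filter (· ∈ Nat.factoredNumbers S),
      (1 : ℝ) / n₁ * ‖∑ m ∈ Finset.Icc ((⌈X⌉₊ + n₁ - 1) / n₁) (⌊2 * X⌋₊ / n₁), siftedTwistC f S t m / m‖ ≤
        (1 : ℝ) / n₁ * Bnd := by
    intro n₁ hn₁
    rw [Finset.mem_filter, Finset.mem_Icc] at hn₁
    refine mul_le_mul_of_nonneg_left ?_ (by positivity)
    have hn₁Z : (n₁ : ℝ) ≤ X ^ (3 / 4 : ℝ) :=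
      (Nat.cast_le.2 hn₁.1.2).trans (Nat.floor_le (by positivity))
    exact fibre_bound hC_H hH hf hf1 hX1 hY4 hTH hM₀ hn₁.1.1 hn₁Z
  calc ∑ n₁ ∈ (Finset.Icc 1 ⌊X ^ (3 / 4 : ℝ)⌋₊).filter (· ∈ Nat.factoredNumbers S),
        (1 : ℝ) / n₁ * ‖∑ m ∈ Finset.Icc ((⌈X⌉₊ + n₁ - 1) / n₁) (⌊2 * X⌋₊ / n₁), siftedTwistC f S t m / m‖
      ≤ ∑ n₁ ∈ (Finset.Icc 1 ⌊X ^ (3 / 4 : ℝ)⌋₊).filter (· ∈ Nat.factoredNumbers S), (1 : ℝ) / n₁ * Bnd :=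
        Finset.sum_le_sum hfib
    _ = (∑ n₁ ∈ (Finset.Icc 1 ⌊X ^ (3 / 4 : ℝ)⌋₊).filter (· ∈ Nat.factoredNumbers S), (1 : ℝ) / n₁) * Bnd := by
        rw [Finset.sum_mul]
    _ ≤ Real.exp (SigAll S + RankinComposed.C₀) * Bnd := by
        refine mul_le_mul_of_nonneg_right (sum_inv_factored_le hS _) ?_
        -- `Bnd ≥ 0`
        have hY : (1 : ℝ) < Ystar X := by linarith
        have : 0 ≤ Real.log (Real.log (2 * X)) / Real.log (Ystar X) := by
          refine div_nonneg (Real.log_nonneg ?_) (Real.log_nonneg hY.le)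
          have hX8 : (8 : ℝ) ≤ X := by
            have hYdef : Ystar X = X ^ (1 / 4 : ℝ) / 2 := rfl
            have h14 : X ^ (1 / 4 : ℝ) ≤ X := by
              calc X ^ (1 / 4 : ℝ) ≤ X ^ (1 : ℝ) := Real.rpow_le_rpow_of_exponent_le hX1 (by norm_num)
                _ = X := Real.rpow_one X
            rw [hYdef] at hY4; linarith
          rw [← Real.log_exp 1]; refine Real.log_le_log (Real.exp_pos 1) ?_
          have := Real.exp_one_lt_d9; norm_num at this; linarith
        positivity

/-! ### The second part: trivial bound and Rankin's bound -/

/-- **Trivial bound** for any part of `R(1+it)`: `‖∑_{X ≤ n ≤ 2X, n ∈ B} F(n)‖ ≤ 2`. [folklore] -/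
theorem norm_sum_filter_summandRC_le_two {f : ArithmeticFunction ℂ} (hf1 : ∀ n, ‖f n‖ ≤ 1) (P Q t : ℝ)
    {X : ℝ} (hX : 1 ≤ X) (B : ℕ → Prop) [DecidablePred B] :
    ‖∑ n ∈ (Finset.Icc ⌈X⌉₊ ⌊2 * X⌋₊).filter B, summandRC f P Q t n‖ ≤ 2 := by
  have hL : 1 ≤ ⌈X⌉₊ := Nat.one_le_iff_ne_zero.2 (Nat.ceil_pos.2 (by linarith)).ne'
  calc ‖∑ n ∈ (Finset.Icc ⌈X⌉₊ ⌊2 * X⌋₊).filter B, summandRC f P Q t n‖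
      ≤ ∑ n ∈ (Finset.Icc ⌈X⌉₊ ⌊2 * X⌋₊).filter B, ‖summandRC f P Q t n‖ := norm_sum_le _ _
    _ ≤ ∑ n ∈ (Finset.Icc ⌈X⌉₊ ⌊2 * X⌋₊).filter B, (1 : ℝ) / n := Finset.sum_le_sum fun n hn => by
        have : 1 ≤ n := hL.trans (Finset.mem_Icc.1 (Finset.mem_filter.1 hn).1).1
        exact norm_summandRC_le hf1 P Q t this
    _ ≤ ∑ n ∈ Finset.Icc ⌈X⌉₊ ⌊2 * X⌋₊, (1 : ℝ) / n :=
        Finset.sum_le_sum_of_subset_of_nonneg (Finset.filter_subset _ _) fun _ _ _ => by positivity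
    _ ≤ 2 := sum_inv_Icc_le_two hX

/-- **Rankin's bound for the second part**: for `0 < η ≤ 2/5` and `X ≥ 1`,
`‖∑_{X ≤ n ≤ 2X, s_S(n) > X^{3/4}} F(n)‖ ≤ (1 + log (2X)) X^{-3η/4} exp(∑_{p ∈ S} p^{-(1-η)} + C₀)`.
[cite: MatomakiRadziwillAnnals2016, Lemma 3 (proof: "by an estimate for the number of Q-smooth numbers")] -/
theorem second_part_rankin {f : ArithmeticFunction ℂ} (hf1 : ∀ n, ‖f n‖ ≤ 1) (P Q t : ℝ) {X : ℝ} (hX : 1 ≤ X)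
    {η : ℝ} (hη0 : 0 < η) (hη : η ≤ 2 / 5) :
    ‖∑ n ∈ (Finset.Icc ⌈X⌉₊ ⌊2 * X⌋₊).filter (fun n => ⌊X ^ (3 / 4 : ℝ)⌋₊ < sPart (primesPQ P Q) n),
        summandRC f P Q t n‖ ≤
      (1 + Real.log (2 * X)) * (X ^ (-(3 * η / 4))) *
        Real.exp (∑ p ∈ primesPQ P Q, (p : ℝ) ^ (-(1 - η)) + RankinComposed.C₀) := by
  set S := primesPQ P Q with hSdef
  have hS : ∀ p ∈ S, p.Prime := primesPQ_prime
  have hX0 : 0 < X := by linarith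
  have hL : 1 ≤ ⌈X⌉₊ := Nat.one_le_iff_ne_zero.2 (Nat.ceil_pos.2 hX0).ne'
  set Zn := ⌊X ^ (3 / 4 : ℝ)⌋₊ with hZn
  have h1 := norm_sum_large_sPart_le hf1 P Q t (L := ⌈X⌉₊) (U := ⌊2 * X⌋₊) (Zn := Zn) hL
  rw [← hSdef] at h1
  refine h1.trans ?_
  -- the harmonic factor
  have hM : ∑ n₂ ∈ Finset.Icc 1 (⌊2 * X⌋₊ / (Zn + 1)), (1 : ℝ) / n₂ ≤ 1 + Real.log (2 * X) := by
    rcases Nat.eq_zero_or_pos (⌊2 * X⌋₊ / (Zn + 1)) with h0 | hpos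
    · rw [h0]; simp
      have : 0 ≤ Real.log (2 * X) := Real.log_nonneg (by linarith)
      linarith
    · refine (sum_inv_le_one_add_log _).trans ?_
      have : ((⌊2 * X⌋₊ / (Zn + 1) : ℕ) : ℝ) ≤ 2 * X :=
        (Nat.cast_le.2 (Nat.div_le_self _ _)).trans (Nat.floor_le (by linarith))
      have h0' : (0 : ℝ) < ((⌊2 * X⌋₊ / (Zn + 1) : ℕ) : ℝ) := by exact_mod_cast hpos
      linarith [Real.log_le_log h0' this]
  -- Rankin on the `n₁`-sum
  have hZ : (0 : ℝ) < (Zn : ℝ) + 1 := by positivity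
  have hR := RankinComposed.sum_inv_le_rankin hS (σ := 1 - η) (by linarith) (by linarith) hZ
    (R := (Finset.Icc (Zn + 1) ⌊2 * X⌋₊).filter (· ∈ Nat.factoredNumbers S)) (fun n hn => by
      rw [Finset.mem_filter, Finset.mem_Icc] at hn
      exact ⟨hn.2, by exact_mod_cast hn.1.1⟩)
  have hprod := RankinComposed.prod_inv_le_exp hS (σ := 1 - η) (by linarith)
  have hZpow : ((Zn : ℝ) + 1) ^ (-(1 - (1 - η))) ≤ X ^ (-(3 * η / 4)) := by
    have e1 : -(1 - (1 - η)) = -η := by ring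
    rw [e1]
    have hZX : X ^ (3 / 4 : ℝ) ≤ (Zn : ℝ) + 1 := (Nat.lt_floor_add_one _).le
    calc ((Zn : ℝ) + 1) ^ (-η) ≤ (X ^ (3 / 4 : ℝ)) ^ (-η) :=
          Real.rpow_le_rpow_of_nonpos (by positivity) hZX (by linarith)
      _ = X ^ (-(3 * η / 4)) := by rw [← Real.rpow_mul hX0.le]; ring_nf
  have hsum0 : 0 ≤ ∑ n₁ ∈ (Finset.Icc (Zn + 1) ⌊2 * X⌋₊).filter (· ∈ Nat.factoredNumbers S), (1 : ℝ) / n₁ :=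
    Finset.sum_nonneg fun _ _ => by positivity
  have hH0 : 0 ≤ ∑ n₂ ∈ Finset.Icc 1 (⌊2 * X⌋₊ / (Zn + 1)), (1 : ℝ) / n₂ :=
    Finset.sum_nonneg fun _ _ => by positivity
  calc (∑ n₂ ∈ Finset.Icc 1 (⌊2 * X⌋₊ / (Zn + 1)), (1 : ℝ) / n₂) *
        ∑ n₁ ∈ (Finset.Icc (Zn + 1) ⌊2 * X⌋₊).filter (· ∈ Nat.factoredNumbers S), (1 : ℝ) / n₁
      ≤ (1 + Real.log (2 * X)) *
          ((((Zn : ℝ) + 1) ^ (-(1 - (1 - η)))) * ∏ p ∈ S, (1 - (p : ℝ) ^ (-(1 - η)))⁻¹) :=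
        mul_le_mul hM hR hsum0 (by linarith [hH0.trans hM])
    _ ≤ (1 + Real.log (2 * X)) * (X ^ (-(3 * η / 4)) *
          Real.exp (∑ p ∈ S, (p : ℝ) ^ (-(1 - η)) + RankinComposed.C₀)) := by
        refine mul_le_mul_of_nonneg_left ?_ (by linarith [hH0.trans hM])
        refine mul_le_mul hZpow hprod ?_ (by positivity)
        exact Finset.prod_nonneg fun p hp => inv_nonneg.2 (by
          have : (p : ℝ) ^ (-(1 - η)) ≤ 1 := Real.rpow_le_one_of_one_le_of_nonpos
            (by exact_mod_cast (hS p hp).one_lt.le) (by linarith)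
          linarith)
    _ = _ := by ring

/-- **Case (b1)** of the second part: `1 < u = log X/log Q ≤ Q^{2/5}` and `log X < e^{(u/3) log u}`.
Rankin with `η = log u / log Q` gives `E ≤ 6 e^{C_M + 3 + C₀ + 24 e^{288}} · T₂`. [folklore] -/
theorem second_b1 {C_M : ℝ}
    (hCM : ∀ P Q : ℕ, 2 ≤ P → P ≤ Q → |∑ p ∈ (Finset.Icc P Q).filter Nat.Prime, (1 : ℝ) / p
        - (Real.log (Real.log Q) - Real.log (Real.log P))| ≤ C_M)
    {f : ArithmeticFunction ℂ} (hf1 : ∀ n, ‖f n‖ ≤ 1) {P Q X t : ℝ} (hP : 2 ≤ P) (hPQ : P ≤ Q) (hQX : Q ≤ X)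
    (hlogX : 1 ≤ Real.log X) {u : ℝ} (hu : u = Real.log X / Real.log Q) (hu1 : 1 < u)
    (huQ : Real.log u ≤ (2 / 5) * Real.log Q) (hT2 : Real.log X < Real.exp (u / 3 * Real.log u)) :
    ‖∑ n ∈ (Finset.Icc ⌈X⌉₊ ⌊2 * X⌋₊).filter (fun n => ⌊X ^ (3 / 4 : ℝ)⌋₊ < sPart (primesPQ P Q) n),
        summandRC f P Q t n‖ ≤
      6 * Real.exp (C_M + 3 + RankinComposed.C₀ + 24 * Real.exp 288) *
        (Real.log X * Real.exp (-(Real.log X / (3 * Real.log Q)) * Real.log (Real.log X / Real.log Q))) := by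
  have hQ2 : 2 ≤ Q := hP.trans hPQ
  have hQ0 : 0 < Q := by linarith
  have hX1 : 1 ≤ X := by linarith
  have hX0 : 0 < X := by linarith
  have hlogQ : 0 < Real.log Q := Real.log_pos (by linarith)
  have hlogP : 0 < Real.log P := Real.log_pos (by linarith)
  have hlogu : 0 < Real.log u := Real.log_pos hu1
  set η : ℝ := Real.log u / Real.log Q with hη
  have hη0 : 0 < η := div_pos hlogu hlogQ
  have hη25 : η ≤ 2 / 5 := by rw [hη, div_le_iff₀ hlogQ]; linarith
  have hE := second_part_rankin hf1 P Q t hX1 hη0 hη25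
  refine hE.trans ?_
  -- identify `Q^η = u` and `X^{-3η/4} = e^{-(3/4) u log u}`
  have hlogXu : Real.log X = u * Real.log Q := by rw [hu]; field_simp
  have hQη : Q ^ η = u := by
    rw [Real.rpow_def_of_pos hQ0, hη, show Real.log Q * (Real.log u / Real.log Q) = Real.log u by field_simp,
      Real.exp_log (by linarith)]
  have hXη : X ^ (-(3 * η / 4)) = Real.exp (-(3 / 4) * (u * Real.log u)) := by
    rw [Real.rpow_def_of_pos hX0, hlogXu, hη]; congr 1; field_simp
  -- the prime sum
  have hprime := sum_rpow_primesPQ_le (P := P) hQ2 hη0 (by linarith)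
  rw [hQη] at hprime
  have hexpS := exp_SigAll_le hCM hP hPQ
  have hr : Real.log Q / Real.log P ≤ 2 * Real.log X := by
    rw [div_le_iff₀ hlogP]
    have hl2 : (0.6931471803 : ℝ) < Real.log 2 := Real.log_two_gt_d9
    have : Real.log 2 ≤ Real.log P := Real.log_le_log (by norm_num) hP
    have : Real.log Q ≤ Real.log X := Real.log_le_log hQ0 hQX
    nlinarith
  have h1 : Real.exp (∑ p ∈ primesPQ P Q, (p : ℝ) ^ (-(1 - η)) + RankinComposed.C₀) ≤
      Real.exp C_M * (2 * Real.log X) * Real.exp (3 + 24 * u + RankinComposed.C₀) := by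
    calc Real.exp (∑ p ∈ primesPQ P Q, (p : ℝ) ^ (-(1 - η)) + RankinComposed.C₀)
        ≤ Real.exp (SigAll (primesPQ P Q) + (3 + 24 * u + RankinComposed.C₀)) := Real.exp_le_exp.2 (by linarith)
      _ = Real.exp (SigAll (primesPQ P Q)) * Real.exp (3 + 24 * u + RankinComposed.C₀) := Real.exp_add _ _
      _ ≤ _ := mul_le_mul_of_nonneg_right (hexpS.trans (mul_le_mul_of_nonneg_left hr (Real.exp_pos _).le))
          (Real.exp_pos _).le
  have h2 : 1 + Real.log (2 * X) ≤ 3 * Real.log X := by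
    rw [Real.log_mul (by norm_num) hX0.ne']
    have : Real.log 2 < 1 := by have := Real.log_two_lt_d9; linarith
    linarith
  -- assemble: `E ≤ 3 log X · e^{-(3/4)u log u} · e^{C_M} 2 log X · e^{3 + 24u + C₀}`
  have hulogu : 0 ≤ u * Real.log u := by positivity
  have hmain : (1 + Real.log (2 * X)) * X ^ (-(3 * η / 4)) *
      Real.exp (∑ p ∈ primesPQ P Q, (p : ℝ) ^ (-(1 - η)) + RankinComposed.C₀) ≤
      (3 * Real.log X) * Real.exp (-(3 / 4) * (u * Real.log u)) *
        (Real.exp C_M * (2 * Real.log X) * Real.exp (3 + 24 * u + RankinComposed.C₀)) := by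
    rw [hXη]
    refine mul_le_mul (mul_le_mul_of_nonneg_right h2 (Real.exp_pos _).le) h1 (Real.exp_pos _).le (by positivity)
  refine hmain.trans ?_
  -- compare with `T₂ = log X · e^{-(u/3) log u}` using `log X < e^{(u/3) log u}` and `aux_ulogu`
  have hT2eq : Real.exp (-(Real.log X / (3 * Real.log Q)) * Real.log (Real.log X / Real.log Q)) =
      Real.exp (-(u / 3 * Real.log u)) := by
    rw [← hu]; congr 1; rw [hu]; field_simp
  rw [hT2eq]
  have haux := aux_ulogu u hu1.le
  -- everything in exponentials: `(log X)² e^{-(3/4)uℓu} e^{24u} ≤ log X · e^{(1/3)uℓu} e^{-(3/4)uℓu} e^{24u}`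
  have hlogX0 : 0 < Real.log X := by linarith
  have key : Real.log X * Real.exp (-(3 / 4) * (u * Real.log u)) * Real.exp (3 + 24 * u + RankinComposed.C₀) ≤
      Real.exp (3 + RankinComposed.C₀ + 24 * Real.exp 288) * Real.exp (-(u / 3 * Real.log u)) := by
    calc Real.log X * Real.exp (-(3 / 4) * (u * Real.log u)) * Real.exp (3 + 24 * u + RankinComposed.C₀)
        ≤ Real.exp (u / 3 * Real.log u) * Real.exp (-(3 / 4) * (u * Real.log u)) * Real.exp (3 + 24 * u + RankinComposed.C₀) := by
          gcongr
      _ = Real.exp ((3 + RankinComposed.C₀ + (-(1 / 12) * u * Real.log u + 24 * u)) + (-(u / 3 * Real.log u))) := by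
          rw [← Real.exp_add, ← Real.exp_add]; ring_nf
      _ ≤ Real.exp ((3 + RankinComposed.C₀ + 24 * Real.exp 288) + (-(u / 3 * Real.log u))) :=
          Real.exp_le_exp.2 (by linarith)
      _ = _ := Real.exp_add _ _
  calc 3 * Real.log X * Real.exp (-(3 / 4) * (u * Real.log u)) *
        (Real.exp C_M * (2 * Real.log X) * Real.exp (3 + 24 * u + RankinComposed.C₀))
      = 6 * Real.exp C_M * Real.log X *
          (Real.log X * Real.exp (-(3 / 4) * (u * Real.log u)) * Real.exp (3 + 24 * u + RankinComposed.C₀)) := by ring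
    _ ≤ 6 * Real.exp C_M * Real.log X *
          (Real.exp (3 + RankinComposed.C₀ + 24 * Real.exp 288) * Real.exp (-(u / 3 * Real.log u))) :=
        mul_le_mul_of_nonneg_left key (by positivity)
    _ = 6 * (Real.exp C_M * Real.exp (3 + RankinComposed.C₀ + 24 * Real.exp 288)) *
          (Real.log X * Real.exp (-(u / 3 * Real.log u))) := by ring
    _ = _ := by rw [← Real.exp_add]; ring_nf

/-- **Case (b2-i)** of the second part: `Q < e^{400}`.  Rankin with `η = 2/5` and the crude
`∑_{p ∈ S} p^{-3/5} ≤ #S ≤ Q`: `E ≤ (400/3) e^{e^{400} + C₀} (log X)^{-1/16}`. [folklore] -/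
theorem second_b2i {f : ArithmeticFunction ℂ} (hf1 : ∀ n, ‖f n‖ ≤ 1) {P Q X t : ℝ} (hQ : 2 ≤ Q) (hQX : Q ≤ X)
    (hlogX : 1 ≤ Real.log X) (hQsmall : Q < Real.exp 400) :
    ‖∑ n ∈ (Finset.Icc ⌈X⌉₊ ⌊2 * X⌋₊).filter (fun n => ⌊X ^ (3 / 4 : ℝ)⌋₊ < sPart (primesPQ P Q) n),
        summandRC f P Q t n‖ ≤
      (400 / 3) * Real.exp (Real.exp 400 + RankinComposed.C₀) * (1 / Real.log X ^ (1 / 16 : ℝ)) := by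
  have hX1 : 1 ≤ X := by linarith
  have hX0 : 0 < X := by linarith
  have hE := second_part_rankin hf1 P Q t hX1 (η := 2 / 5) (by norm_num) le_rfl
  refine hE.trans ?_
  -- the prime sum is at most `#S ≤ Q < e^{400}`
  have hS : ∑ p ∈ primesPQ P Q, (p : ℝ) ^ (-(1 - 2 / 5 : ℝ)) ≤ Real.exp 400 := by
    calc ∑ p ∈ primesPQ P Q, (p : ℝ) ^ (-(1 - 2 / 5 : ℝ)) ≤ ∑ p ∈ primesPQ P Q, (1 : ℝ) :=
          Finset.sum_le_sum fun p hp => Real.rpow_le_one_of_one_le_of_nonpos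
            (by exact_mod_cast (primesPQ_prime p hp).one_lt.le) (by norm_num)
      _ = #(primesPQ P Q) := by simp
      _ ≤ ⌊Q⌋₊ := by
          have : #(primesPQ P Q) ≤ #(Finset.Icc 1 ⌊Q⌋₊) := by
            refine Finset.card_le_card fun p hp => ?_
            rw [primesPQ, Finset.mem_filter, Finset.mem_Icc] at hp
            exact Finset.mem_Icc.2 ⟨hp.2.one_lt.le, hp.1.2⟩
          simpa using (show (#(primesPQ P Q) : ℝ) ≤ #(Finset.Icc 1 ⌊Q⌋₊) by exact_mod_cast this)
      _ ≤ Q := Nat.floor_le (by linarith)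
      _ ≤ Real.exp 400 := hQsmall.le
  have h2 : 1 + Real.log (2 * X) ≤ 3 * Real.log X := by
    rw [Real.log_mul (by norm_num) hX0.ne']
    have : Real.log 2 < 1 := by have := Real.log_two_lt_d9; linarith
    linarith
  have h3 : X ^ (-(3 * (2 / 5 : ℝ) / 4)) = X ^ (-(3 / 10 : ℝ)) := by norm_num
  rw [h3]
  have h4 := log_mul_rpow_neg_le hX1 hlogX
  have h5 := inv_log_le_inv_rpow hlogX
  calc (1 + Real.log (2 * X)) * X ^ (-(3 / 10 : ℝ)) * Real.exp (∑ p ∈ primesPQ P Q, (p : ℝ) ^ (-(1 - 2 / 5 : ℝ)) + RankinComposed.C₀)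
      ≤ (3 * Real.log X) * X ^ (-(3 / 10 : ℝ)) * Real.exp (Real.exp 400 + RankinComposed.C₀) := by
        refine mul_le_mul (mul_le_mul_of_nonneg_right h2 (by positivity)) (Real.exp_le_exp.2 (by linarith))
          (Real.exp_pos _).le (by positivity)
    _ = 3 * Real.exp (Real.exp 400 + RankinComposed.C₀) * (Real.log X * X ^ (-(3 / 10 : ℝ))) := by ring
    _ ≤ 3 * Real.exp (Real.exp 400 + RankinComposed.C₀) * ((400 / 9) / Real.log X) :=
        mul_le_mul_of_nonneg_left h4 (by positivity)
    _ = (400 / 3) * Real.exp (Real.exp 400 + RankinComposed.C₀) * (1 / Real.log X) := by ring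
    _ ≤ _ := mul_le_mul_of_nonneg_left h5 (by positivity)

/-- **Case (b2-ii)** of the second part: `Q ≥ e^{400}` and `u = log X/log Q > Q^{2/5}`.  Rankin with
`η = 2/5`, `∑_{p ∈ S} p^{-3/5} ≤ Q^{2/5} (log log Q + 4) ≤ u (log log Q + 4)`, so the exponent is
`≤ −u ((3/10) log Q − log log Q − 4) ≤ −u`, and `log X · e^{-u} (log X)^{1/16} ≤ (log X)² e^{-u} ≤ 150`:
`E ≤ 450 e^{C₀} (log X)^{-1/16}`. [folklore] -/
theorem second_b2ii {f : ArithmeticFunction ℂ} (hf1 : ∀ n, ‖f n‖ ≤ 1) {P Q X t : ℝ} (hQX : Q ≤ X)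
    (hlogX : 1 ≤ Real.log X) (hQbig : Real.exp 400 ≤ Q) {u : ℝ} (hu : u = Real.log X / Real.log Q)
    (huQ : (2 / 5) * Real.log Q < Real.log u) :
    ‖∑ n ∈ (Finset.Icc ⌈X⌉₊ ⌊2 * X⌋₊).filter (fun n => ⌊X ^ (3 / 4 : ℝ)⌋₊ < sPart (primesPQ P Q) n),
        summandRC f P Q t n‖ ≤
      450 * Real.exp RankinComposed.C₀ * (1 / Real.log X ^ (1 / 16 : ℝ)) := by
  have hQ400 : (400 : ℝ) ≤ Real.exp 400 := by have := Real.add_one_le_exp (400:ℝ); linarith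
  have hQ2 : (2 : ℝ) ≤ Q := by linarith
  have hQ0 : 0 < Q := by linarith
  have hX1 : 1 ≤ X := by linarith
  have hX0 : 0 < X := by linarith
  have hlogQ : 400 ≤ Real.log Q := by
    have := Real.log_le_log (Real.exp_pos 400) hQbig; rwa [Real.log_exp] at this
  have hlogQ0 : 0 < Real.log Q := by linarith
  have hu1 : 1 ≤ u := by rw [hu, le_div_iff₀ hlogQ0, one_mul]; exact Real.log_le_log hQ0 hQX
  have hu0 : 0 < u := by linarith
  have hlogXu : Real.log X = u * Real.log Q := by rw [hu]; field_simp
  have hE := second_part_rankin hf1 P Q t hX1 (η := 2 / 5) (by norm_num) le_rfl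
  refine hE.trans ?_
  -- the prime sum: `∑_{p ∈ S} p^{-3/5} ≤ Q^{2/5} (log log Q + 4) ≤ u (log log Q + 4)`
  have hllQ : 0 ≤ Real.log (Real.log Q) := Real.log_nonneg (by linarith)
  have hQpow : Q ^ (2 / 5 : ℝ) ≤ u := by
    have : Real.log (Q ^ (2 / 5 : ℝ)) ≤ Real.log u := by rw [Real.log_rpow hQ0]; linarith
    exact (Real.log_le_log_iff (by positivity) hu0).1 this
  have hS : ∑ p ∈ primesPQ P Q, (p : ℝ) ^ (-(1 - 2 / 5 : ℝ)) ≤ u * (Real.log (Real.log Q) + 4) := by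
    have hpt : ∀ p ∈ primesPQ P Q, (p : ℝ) ^ (-(1 - 2 / 5 : ℝ)) ≤ Q ^ (2 / 5 : ℝ) * (1 / p) := by
      intro p hp
      have hp' := hp; rw [primesPQ, Finset.mem_filter, Finset.mem_Icc] at hp'
      have hp0 : (0 : ℝ) < p := by exact_mod_cast hp'.2.pos
      have hpQ : (p : ℝ) ≤ Q := (Nat.cast_le.2 hp'.1.2).trans (Nat.floor_le hQ0.le)
      rw [show (-(1 - 2 / 5 : ℝ)) = 2 / 5 + (-1) by norm_num, Real.rpow_add hp0, Real.rpow_neg_one, one_div]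
      exact mul_le_mul_of_nonneg_right (Real.rpow_le_rpow hp0.le hpQ (by norm_num)) (by positivity)
    have hsub : primesPQ P Q ⊆ Nat.primesLE ⌊Q⌋₊ := fun p hp => by
      rw [primesPQ, Finset.mem_filter, Finset.mem_Icc] at hp
      exact Nat.mem_primesLE.2 ⟨hp.1.2, hp.2⟩
    have hQ2' : 2 ≤ ⌊Q⌋₊ := Nat.le_floor (by simpa using hQ2)
    have hM := Literature.NumberTheory.LFunctions.MertensBound.sum_inv_prime_le ⌊Q⌋₊ hQ2'
    have hllQ' : Real.log (Real.log (⌊Q⌋₊ : ℝ)) ≤ Real.log (Real.log Q) := by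
      have h2 : (2:ℝ) ≤ ⌊Q⌋₊ := by exact_mod_cast hQ2'
      exact Real.log_le_log (Real.log_pos (by linarith)) (Real.log_le_log (by linarith) (Nat.floor_le hQ0.le))
    calc ∑ p ∈ primesPQ P Q, (p : ℝ) ^ (-(1 - 2 / 5 : ℝ)) ≤ ∑ p ∈ primesPQ P Q, Q ^ (2 / 5 : ℝ) * (1 / p) :=
          Finset.sum_le_sum hpt
      _ = Q ^ (2 / 5 : ℝ) * ∑ p ∈ primesPQ P Q, (1 : ℝ) / p := by rw [Finset.mul_sum]
      _ ≤ Q ^ (2 / 5 : ℝ) * ∑ p ∈ Nat.primesLE ⌊Q⌋₊, (1 : ℝ) / p :=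
          mul_le_mul_of_nonneg_left (Finset.sum_le_sum_of_subset_of_nonneg hsub fun _ _ _ => by positivity) (by positivity)
      _ ≤ Q ^ (2 / 5 : ℝ) * (Real.log (Real.log Q) + 4) := mul_le_mul_of_nonneg_left (by linarith) (by positivity)
      _ ≤ u * (Real.log (Real.log Q) + 4) := mul_le_mul_of_nonneg_right hQpow (by linarith)
  -- exponent bound
  have hauxL := aux_L hlogQ
  have hXpow : X ^ (-(3 * (2 / 5 : ℝ) / 4)) = Real.exp (-(3 / 10) * (u * Real.log Q)) := by
    rw [Real.rpow_def_of_pos hX0, hlogXu]; congr 1; ring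
  have hexp : X ^ (-(3 * (2 / 5 : ℝ) / 4)) * Real.exp (∑ p ∈ primesPQ P Q, (p : ℝ) ^ (-(1 - 2 / 5 : ℝ)) + RankinComposed.C₀) ≤
      Real.exp RankinComposed.C₀ * Real.exp (-u) := by
    rw [hXpow, ← Real.exp_add, ← Real.exp_add]
    refine Real.exp_le_exp.2 ?_
    nlinarith
  have h2 : 1 + Real.log (2 * X) ≤ 3 * Real.log X := by
    rw [Real.log_mul (by norm_num) hX0.ne']
    have : Real.log 2 < 1 := by have := Real.log_two_lt_d9; linarith
    linarith
  -- `log X · e^{-u} ≤ 150 / log X`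
  have hlogu : Real.log u ≤ u := by have := Real.log_le_sub_one_of_pos hu0; linarith
  have hlogXle : Real.log X ≤ (5 / 2) * u ^ 2 := by
    rw [hlogXu]
    have : Real.log Q < (5 / 2) * Real.log u := by linarith
    nlinarith
  have hkey : Real.log X * Real.exp (-u) ≤ 150 / Real.log X := by
    rw [le_div_iff₀ (by linarith)]
    have h4 := pow_four_mul_exp_neg_le hu0.le
    have : Real.log X * Real.exp (-u) * Real.log X = Real.log X ^ 2 * Real.exp (-u) := by ring
    rw [this]
    have hsq : Real.log X ^ 2 ≤ (25 / 4) * u ^ 4 := by nlinarith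
    nlinarith [Real.exp_pos (-u)]
  have h5 := inv_log_le_inv_rpow hlogX
  calc (1 + Real.log (2 * X)) * X ^ (-(3 * (2 / 5 : ℝ) / 4)) *
        Real.exp (∑ p ∈ primesPQ P Q, (p : ℝ) ^ (-(1 - 2 / 5 : ℝ)) + RankinComposed.C₀)
      = (1 + Real.log (2 * X)) * (X ^ (-(3 * (2 / 5 : ℝ) / 4)) *
        Real.exp (∑ p ∈ primesPQ P Q, (p : ℝ) ^ (-(1 - 2 / 5 : ℝ)) + RankinComposed.C₀)) := by ring
    _ ≤ (3 * Real.log X) * (Real.exp RankinComposed.C₀ * Real.exp (-u)) :=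
        mul_le_mul h2 hexp (by positivity) (by positivity)
    _ = 3 * Real.exp RankinComposed.C₀ * (Real.log X * Real.exp (-u)) := by ring
    _ ≤ 3 * Real.exp RankinComposed.C₀ * (150 / Real.log X) := mul_le_mul_of_nonneg_left hkey (by positivity)
    _ = 450 * Real.exp RankinComposed.C₀ * (1 / Real.log X) := by ring
    _ ≤ _ := mul_le_mul_of_nonneg_left h5 (by positivity)

/-! ### The two parts in terms of `T₁ = log Q/((log X)^{1/16} log P)` and `T₂ = log X · e^{-(u/3) log u}` -/

/-- **The second part, all cases**: `E ≤ K₂ (T₁ + T₂)` with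
`K₂ = 2 + 6 e^{C_M + 3 + C₀ + 24e^{288}} + (400/3) e^{e^{400} + C₀} + 450 e^{C₀}`. [folklore] -/
theorem second_part_numeric {C_M : ℝ}
    (hCM : ∀ P Q : ℕ, 2 ≤ P → P ≤ Q → |∑ p ∈ (Finset.Icc P Q).filter Nat.Prime, (1 : ℝ) / p
        - (Real.log (Real.log Q) - Real.log (Real.log P))| ≤ C_M)
    {f : ArithmeticFunction ℂ} (hf1 : ∀ n, ‖f n‖ ≤ 1) {P Q X t : ℝ} (hP : 2 ≤ P) (hPQ : P ≤ Q) (hQX : Q ≤ X)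
    (hlogX : 1 ≤ Real.log X) :
    ‖∑ n ∈ (Finset.Icc ⌈X⌉₊ ⌊2 * X⌋₊).filter (fun n => ⌊X ^ (3 / 4 : ℝ)⌋₊ < sPart (primesPQ P Q) n),
        summandRC f P Q t n‖ ≤
      (2 + 6 * Real.exp (C_M + 3 + RankinComposed.C₀ + 24 * Real.exp 288) +
        (400 / 3) * Real.exp (Real.exp 400 + RankinComposed.C₀) + 450 * Real.exp RankinComposed.C₀) *
        (T1 X P Q + T2 X Q) := by
  classical
  set K_b1 := 6 * Real.exp (C_M + 3 + RankinComposed.C₀ + 24 * Real.exp 288) with hKb1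
  set K_b2i := (400 / 3) * Real.exp (Real.exp 400 + RankinComposed.C₀) with hKb2i
  set K_b2ii := 450 * Real.exp RankinComposed.C₀ with hKb2ii
  have hQ2 : 2 ≤ Q := hP.trans hPQ
  have hQ0 : 0 < Q := by linarith
  have hX1 : 1 ≤ X := by linarith
  have hlogQ : 0 < Real.log Q := Real.log_pos (by linarith)
  have hlogX0 : 0 < Real.log X := by linarith
  have hT1 := inv_rpow_le_T1 hP hPQ hlogX0
  have hT1pos : 0 < T1 X P Q := lt_of_lt_of_le (by positivity) hT1
  have hT2pos := T2_pos (Q := Q) hlogX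
  have hK0 : 0 ≤ K_b1 ∧ 0 ≤ K_b2i ∧ 0 ≤ K_b2ii := ⟨by positivity, by positivity, by positivity⟩
  set E := ‖∑ n ∈ (Finset.Icc ⌈X⌉₊ ⌊2 * X⌋₊).filter (fun n => ⌊X ^ (3 / 4 : ℝ)⌋₊ < sPart (primesPQ P Q) n),
        summandRC f P Q t n‖ with hEdef
  have hsum : ∀ {K : ℝ}, 0 ≤ K → K ≤ 2 + K_b1 + K_b2i + K_b2ii →
      ∀ {B : ℝ}, E ≤ K * B → 0 ≤ B → B ≤ T1 X P Q + T2 X Q →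
        E ≤ (2 + K_b1 + K_b2i + K_b2ii) * (T1 X P Q + T2 X Q) := by
    intro K hK hKle B hE hB hBle
    calc E ≤ K * B := hE
      _ ≤ (2 + K_b1 + K_b2i + K_b2ii) * (T1 X P Q + T2 X Q) := mul_le_mul hKle hBle hB (by linarith)
  by_cases hcaseA : 1 ≤ T2 X Q
  · -- trivial bound
    have hE2 : E ≤ 2 * T2 X Q := (norm_sum_filter_summandRC_le_two hf1 P Q t hX1 _).trans (by linarith)
    exact hsum (by norm_num) (by linarith [hK0.1, hK0.2.1, hK0.2.2]) hE2 hT2pos.le (by linarith)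
  · push Not at hcaseA
    set u := Real.log X / Real.log Q with hu
    have hu1 : 1 ≤ u := by rw [hu, le_div_iff₀ hlogQ, one_mul]; exact Real.log_le_log hQ0 hQX
    -- `T₂ < 1 ≤ log X` forces `log u > 0`
    have hT2' : Real.log X < Real.exp (u / 3 * Real.log u) := by
      have h := hcaseA
      unfold T2 at h
      have e : -(Real.log X / (3 * Real.log Q)) * Real.log (Real.log X / Real.log Q) = -(u / 3 * Real.log u) := by
        rw [hu]; ring
      rw [e, Real.exp_neg] at h
      rwa [mul_inv_lt_iff₀ (Real.exp_pos _), one_mul] at h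
    have hu1' : 1 < u := by
      by_contra h; push Not at h
      have hu_eq : u = 1 := le_antisymm h hu1
      rw [hu_eq, Real.log_one, mul_zero, Real.exp_zero] at hT2'
      linarith
    by_cases hcaseB : Real.log u ≤ (2 / 5) * Real.log Q
    · have hE := second_b1 hCM hf1 hP hPQ hQX hlogX hu hu1' hcaseB hT2' (t := t)
      exact hsum hK0.1 (by linarith [hK0.2.1, hK0.2.2]) hE hT2pos.le
        (by show T2 X Q ≤ T1 X P Q + T2 X Q; linarith)
    · push Not at hcaseB
      by_cases hcaseC : Q < Real.exp 400
      · have hE := second_b2i hf1 (P := P) (t := t) hQ2 hQX hlogX hcaseC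
        exact hsum hK0.2.1 (by linarith [hK0.1, hK0.2.2]) hE (by positivity) (by linarith)
      · push Not at hcaseC
        have hE := second_b2ii hf1 (P := P) (t := t) hQX hlogX hcaseC hu hcaseB
        exact hsum hK0.2.2 (by linarith [hK0.1, hK0.2.1]) hE (by positivity) (by linarith)


end MatomakiRadziwillL3C

end Literature.NumberTheory.Sieve
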